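/-
Copyright (c) 2026. All rights reserved.
Released under Apache 2.0 license as described in the file LICENSE.
Authors: abc-iut cell, seat abc-iut-L4-t14 (gen 5; proof-only: `PSL₂(ℝ)` has finite index in
`PGL(2, ℝ) = Isom(ℍ)`, hence `[N_{PGL₂(ℝ)}(Λ̄) : Λ̄] < ∞` follows from `[N_{PSL₂(ℝ)}(Λ̄) : Λ̄] < ∞` — one
hypothesis currency for the holomorphic and the RC geometric columns of [AbsTopIII] Prop 4.2 (i)).
-/
import Literature.AnabelianGeometry.AbsoluteAnabelian.ArchimedeanHolFieldFunctorGeometricPGLCentralizer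
import HarnessLib

/-!
# The normaliser of `Λ̄ ≤ PSL₂(ℝ)` in `PGL(2, ℝ)`: finite index over the normaliser in `PSL₂(ℝ)`

S. Mochizuki, *Topics in absolute anabelian geometry III*, proof of Prop 4.2 (i) p. 106 l. 14–19 (kurims
`paper:url-5493eb38cbb7`; bib key `MochizukiAbsTopIII2015`): the id-rigidity of `EA` «follows immediately
from the slimness assertion of Lemma 4.3» for the orbicurve `[X/Aut X]`; at the uniformised model
`X = ℍ/Λ̄` the finiteness of `Aut X` enters as `[N(Λ̄) : Λ̄] < ∞`, with `N = N_{PSL₂(ℝ)}` for HOLOMORPHIC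
automorphisms (abc-iut-L4-t14's hypothesis `hN`, p440736/p449027) and `N = N_{PGL₂(ℝ)}` — `PGL(2, ℝ) =
Isom(ℍ)`, H. M. Farkas, I. Kra, *Riemann Surfaces*, IV.5.6 — for print's RC-holomorphic (holomorphic or
anti-holomorphic) ones (hypothesis `hN'`, p456078).

PROOF-ONLY file (no definition, no named fact) making the two currencies ONE:

* `HolRS.mk_mem_range_toPGL_of_det_pos` — a class in `PGL(2, ℝ)` of positive determinant comes from
  `PSL₂(ℝ)` (scale by `1/√det`);
* `HolRS.finiteIndex_range_toPGL` — **`PSL₂(ℝ)` has FINITE INDEX in `PGL(2, ℝ)`** (its image contains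
  the kernel of Mathlib's `Matrix.ProjGenLinGroup.signDet : PGL(2, ℝ) →* SignTypeˣ`);
* ★ `HolRS.finiteIndex_map_toPGL_normalizer` — **`[N_{PSL₂(ℝ)}(Λ̄) : Λ̄] < ∞ ⟹ [N_{PGL₂(ℝ)}(Λ̄) : Λ̄] < ∞`**
  for every `Λ̄ ≤ PSL₂(ℝ)`: the elements of `N_{PGL₂(ℝ)}(Λ̄)` coming from `PSL₂(ℝ)` are exactly the image
  of `N_{PSL₂(ℝ)}(Λ̄)` (injectivity of `toPGL`), a subgroup of finite index in `N_{PGL₂(ℝ)}(Λ̄)` (index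
  `≤ [PGL(2, ℝ) : PSL₂(ℝ)]`), and relative indices multiply;
* `HolRS.LocObj.finiteIndex_map_toPGL_normalizer` — the same for every object of `Loc(PSL₂(ℝ), Γ̄)`:
  abc-iut-L4-t14's `hN` implies `hN'`.

Classical `2 × 2` algebra and index bookkeeping; MODEL side of [AbsTopIII] §4 only; nothing here bears on
[IUTchIII] Cor. 3.12; model ≠ reconstruction.
-/

set_option autoImplicit false

noncomputable section

open scoped MatrixGroups
open Matrix.ProjectiveSpecialLinearGroup (toPGL toPGL_mk toPGL_injective)

namespace Literature.AnabelianGeometry.AbsoluteAnabelian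

namespace HolRS

/-- **A class in `PGL(2, ℝ)` of positive determinant comes from `PSL₂(ℝ)`** (`g ↦ g/√(det g)`).
[cite: FarkasKra1992, IV.5.6] -/
theorem mk_mem_range_toPGL_of_det_pos (g : GL (Fin 2) ℝ) (hg : 0 < ((Matrix.GeneralLinearGroup.det g : ℝˣ) : ℝ)) :
    Matrix.ProjGenLinGroup.mk g ∈ (toPGL (n := Fin 2) (R := ℝ)).range := by
  -- `r := 1/√(det g)` with `r ^ 2 * det g = 1`
  obtain ⟨r, hr⟩ : ∃ r : ℝˣ, r ^ Fintype.card (Fin 2) * Matrix.GeneralLinearGroup.det g = 1 := by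
    have hs : 0 < Real.sqrt ((Matrix.GeneralLinearGroup.det g : ℝˣ) : ℝ) := Real.sqrt_pos.mpr hg
    refine ⟨Units.mk0 ((Real.sqrt ((Matrix.GeneralLinearGroup.det g : ℝˣ) : ℝ))⁻¹) (inv_ne_zero hs.ne'),
      Units.ext ?_⟩
    simp only [Fintype.card_fin, Units.val_mul, Units.val_pow_eq_pow_val, Units.val_mk0, Units.val_one]
    rw [inv_pow, Real.sq_sqrt hg.le, inv_mul_cancel₀ hg.ne']
  simp only [Units.ext_iff, Units.val_mul, Units.val_pow_eq_pow_val,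
    Matrix.GeneralLinearGroup.val_det_apply, ← Matrix.det_smul g.1 r.1, Units.val_one] at hr
  refine ⟨QuotientGroup.mk ⟨r.1 • g.1, hr⟩, ?_⟩
  simp only [toPGL_mk, Matrix.ProjGenLinGroup.mk_eq_mk_iff]
  refine ⟨r⁻¹, Units.ext ?_⟩
  simp only [Units.val_mul, Matrix.SpecialLinearGroup.coe_GL_coe_matrix,
    Matrix.GeneralLinearGroup.coe_scalar]
  simp [← Matrix.mul_smul, ← Matrix.diagonal_smul, Pi.smul_def, smul_eq_mul]

/-- **`PSL₂(ℝ)` has finite index in `PGL(2, ℝ)`**: its image contains the kernel of the sign-of-determinant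
character `Matrix.ProjGenLinGroup.signDet : PGL(2, ℝ) →* SignTypeˣ`, whose index is the (finite) order
of its image. [cite: FarkasKra1992, IV.5.6] -/
theorem finiteIndex_range_toPGL : (toPGL (n := Fin 2) (R := ℝ)).range.FiniteIndex := by
  haveI : Fact (Even (Fintype.card (Fin 2))) := ⟨by rw [Fintype.card_fin]; exact even_two⟩
  have hle : (Matrix.ProjGenLinGroup.signDet (n := Fin 2) (R := ℝ)).ker ≤
      (toPGL (n := Fin 2) (R := ℝ)).range := by
    intro x hx
    induction x using Matrix.ProjGenLinGroup.induction_on with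
    | mk g =>
      rw [MonoidHom.mem_ker] at hx
      have hsign : SignType.sign ((Matrix.GeneralLinearGroup.det g : ℝˣ) : ℝ) = 1 := by
        have := congrArg (fun u : SignTypeˣ => (u : SignType)) hx
        simpa only [Matrix.ProjGenLinGroup.val_signDet_mk, Units.val_one] using this
      exact mk_mem_range_toPGL_of_det_pos g (sign_eq_one_iff.mp hsign)
  haveI : (Matrix.ProjGenLinGroup.signDet (n := Fin 2) (R := ℝ)).ker.FiniteIndex := by
    refine ⟨?_⟩
    rw [Subgroup.index_ker]
    exact Nat.card_pos.ne'
  exact Subgroup.finiteIndex_of_le hle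

/-- ★ **PSL → PGL normaliser bridge: `[N_{PSL₂(ℝ)}(Λ̄) : Λ̄] < ∞ ⟹ [N_{PGL₂(ℝ)}(Λ̄) : Λ̄] < ∞`.**  For
`Λ̄ ≤ PSL₂(ℝ)` write `Λ̄' ≤ PGL(2, ℝ)` for its image.  The elements of `N_{PGL₂(ℝ)}(Λ̄')` in the image of
`PSL₂(ℝ)` are the image of `N_{PSL₂(ℝ)}(Λ̄)` (injectivity of `toPGL`); that image has finite index in
`N_{PGL₂(ℝ)}(Λ̄')` (`≤ [PGL(2, ℝ) : PSL₂(ℝ)]`), and relative indices multiply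
(`Subgroup.relIndex_ne_zero_trans`).  So abc-iut-L4-t14's hypothesis `hN` (holomorphic column) implies
`hN'` (RC column). [cite: MochizukiAbsTopIII2015, Proposition 4.2 (i) proof p.106] -/
theorem finiteIndex_map_toPGL_normalizer (Λ : Subgroup PSL2R)
    [hN : (Λ.subgroupOf (Subgroup.normalizer (Λ : Set PSL2R))).FiniteIndex] :
    ((Λ.map (toPGL (n := Fin 2) (R := ℝ))).subgroupOf
      (Subgroup.normalizer ((Λ.map (toPGL (n := Fin 2) (R := ℝ)) : Subgroup PGL(2, ℝ)) :
        Set PGL(2, ℝ)))).FiniteIndex := by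
  set f : PSL2R →* PGL(2, ℝ) := toPGL (n := Fin 2) (R := ℝ) with hf
  have hfi : Function.Injective f := toPGL_injective
  set Λ' : Subgroup PGL(2, ℝ) := Λ.map f with hΛ'
  set N : Subgroup PSL2R := Subgroup.normalizer (Λ : Set PSL2R) with hNdef
  set N' : Subgroup PGL(2, ℝ) := Subgroup.normalizer (Λ' : Set PGL(2, ℝ)) with hN'def
  set R : Subgroup PGL(2, ℝ) := f.range with hR
  -- (1) `[f(N) : Λ̄'] = [N : Λ̄] < ∞`
  have h1 : Λ'.relIndex (N.map f) ≠ 0 := by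
    rw [hΛ', Subgroup.relIndex_map_map_of_injective Λ N hfi]
    exact hN.index_ne_zero
  -- (2) `N' ∩ f(PSL₂(ℝ)) ≤ f(N)`
  have h2 : N' ⊓ R ≤ N.map f := by
    intro x hx
    obtain ⟨hxN, hxR⟩ := Subgroup.mem_inf.mp hx
    obtain ⟨y, rfl⟩ := MonoidHom.mem_range.mp hxR
    refine Subgroup.mem_map.mpr ⟨y, ?_, rfl⟩
    rw [hN'def, Subgroup.mem_normalizer_iff] at hxN
    rw [hNdef, Subgroup.mem_normalizer_iff]
    intro h
    rw [← Subgroup.mem_map_iff_mem hfi (K := Λ), ← hΛ', hxN (f h), ← map_mul, ← map_inv, ← map_mul, hΛ',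
      Subgroup.mem_map_iff_mem hfi]
  -- (3) `f(PSL₂(ℝ))`, hence `N' ∩ f(PSL₂(ℝ))`, hence `f(N)`, has finite relative index in `N'`
  have hRN : R.relIndex N' ≠ 0 := by
    haveI : R.FiniteIndex := finiteIndex_range_toPGL
    have htop : R.relIndex ⊤ ≠ 0 := by
      rw [Subgroup.relIndex_top_right]
      exact Subgroup.FiniteIndex.index_ne_zero
    exact fun h0 => htop (Subgroup.relIndex_eq_zero_of_le_right le_top h0)
  have h3 : (N' ⊓ R).relIndex N' ≠ 0 := by
    rw [inf_comm, Subgroup.inf_relIndex_right]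
    exact hRN
  have h4 : (N.map f).relIndex N' ≠ 0 := fun h0 =>
    h3 (Nat.eq_zero_of_zero_dvd (h0 ▸ Subgroup.relIndex_dvd_of_le_left N' h2))
  -- (4) multiply
  exact ⟨Subgroup.relIndex_ne_zero_trans h1 h4⟩

/-- The bridge at every object of `Loc(PSL₂(ℝ), Γ̄)`: abc-iut-L4-t14's `hN` (holomorphic column,
`[N_{PSL₂(ℝ)}(Λ̄) : Λ̄] < ∞` for all finite-index `Λ̄ ≤ Γ̄`) implies `hN'` (RC column, the same in
`PGL(2, ℝ)`). [cite: MochizukiAbsTopIII2015, Proposition 4.2 (i) proof p.106] -/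
theorem LocObj.finiteIndex_map_toPGL_normalizer {Γ : Subgroup PSL2R}
    (hN : ∀ Λ : _root_.Literature.AnabelianGeometry.AbsoluteAnabelian.LocObj Γ,
      (Λ.toSubgroup.subgroupOf (Subgroup.normalizer (Λ.toSubgroup : Set PSL2R))).FiniteIndex)
    (Λ : _root_.Literature.AnabelianGeometry.AbsoluteAnabelian.LocObj Γ) :
    ((Λ.toSubgroup.map (toPGL (n := Fin 2) (R := ℝ))).subgroupOf
      (Subgroup.normalizer ((Λ.toSubgroup.map (toPGL (n := Fin 2) (R := ℝ)) : Subgroup PGL(2, ℝ)) :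
        Set PGL(2, ℝ)))).FiniteIndex := by
  haveI := hN Λ
  exact HolRS.finiteIndex_map_toPGL_normalizer Λ.toSubgroup

end HolRS

end Literature.AnabelianGeometry.AbsoluteAnabelian

end
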